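import Summits.Ventures.HSemireg.Mod4TwoSlopeSpectrumGeneral

/-!
# Venture HSemireg — MOD-4 line: h-parts with LEADING TERM IN CODIMENSION `n` (`q_1 = ⋯ = q_{n-1} = 0`, `q_n ≠ 0`, `q_0` and
# `q_{n+1}, …, q_{2n}` arbitrary): `rank H_k(q) = k + 1` for every `k ≤ n − 1`, and `P_f(q) = 2 q_0 q_{2n} + (−1)ⁿ C(2n,n) q_n²`
# (the LOWER SIDE DEGREES of TABLE R's carrier ∕ design rows — `ch(O_Z)`, `1 − ch(O_Z)`, `r + q_n η_n + s·pt` — for EVERY `n`)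

HONEST FRAMING. Part of the Lean index of the computation cell `pub-hsemireg` (seat w3-mod4-1 gen 13, W3 SPECIAL FIBRES; file of
record `HOME/widen/W3/MOD4-OFFSPLIT-w3mod4.md` §8 TABLE R «carrier and design shapes» — rows computed ×2 at `n = 2, 3`
(`(1,8,24,8,1)`, `(1,12,57,112,57,12,1)`) and ×1 at `n = 4` (kit j179422: `(1,16,104,304,480,…)`); §13.19 ∕ 13.21 NET: «still not
covered: ρ(f) ≥ 3 ∕ carrier-design rows»). ELEMENTARY LINEAR ALGEBRA over a field ONLY: no abelian variety, no sheaf, no Ext group,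
no semiregularity map; nothing here says that HC / HC_CM / HC_AV holds; no Literature fact is declared; NO definition is introduced.

WHAT IS PROVED, for a sequence `q` with `q_m = 0` for `1 ≤ m ≤ n − 1` and `q_n ≠ 0` (nothing assumed on `q_0`, `q_{n+1}`, …):
* **`vecMul_hankel1_leading_eq_zero`** — the rows of `H_k(q)` (`k + 1 ≤ n`) are linearly independent: `v ᵥ* H_k(q) = 0 ⇒ v = 0`
  (staircase: column `n − k + j` sees only the rows `≥ k − j`, with pivot `q_n` in row `k − j`);
* **`hankel1_rank_leading`** — hence `rank H_k(q) = k + 1` for every `k ≤ n − 1` (`= Hᵀ`'s rank = the dimension of its source);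
* **`mukaiP_leading`** — `Σ_{j ≤ 2n} (-1)^j C(2n,j) q_j q_{2n-j} = 2 q_0 q_{2n} + (-1)ⁿ C(2n,n) q_n²` (`n ≥ 1`; only `j ∈ {0, n, 2n}`
  survive): «`(f,f)_χ = D·(2 r s + (−1)ⁿ C(2n,n) q_n²)`», the `(w,w)_χ = 2Dq_n²`-type loci of §8 before `∫`.
With `finrank_S_weilType_deg` (FILE 13) this gives the side degrees `R_m = (m+3)C(2n,m) − 2(m+1)C(n,m)` of ALL the §8 rows at once
(`WeilFrameLeadingTerm`); the middle degree (box locus of `M_f(q)`) stays design-specific and is NOT treated here. Everything PROVED,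
0 sorry. Namespace `Summit.Ventures.HSemireg.Mod4`.
References: [BourbakiAlgebre1a3] Ch. III §8 (exterior ∕ matrix rank); [BuchweitzFlenner2008HH] Prop. 6.4.4 (why this matrix).
-/

namespace Summit.Ventures.HSemireg.Mod4

open Finset Matrix

variable {K : Type*} [Field K]

/-- **Staircase:** for `q_m = 0` (`1 ≤ m ≤ n − 1`), `q_n ≠ 0` and `k + 1 ≤ n`, the rows of the Hankel matrix `H_k(q) = (q_{i+s})`
(`i ≤ k`, `s ≤ 2n − k`) are linearly independent: `v ᵥ* H_k(q) = 0` forces `v = 0` (read the columns `s = n − k + j`,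
`j = 0, …, k`: the entries above row `k − j` vanish, the entry in row `k − j` is `q_n`). [cite: BourbakiAlgebre1a3, Ch. III §8] -/
theorem vecMul_hankel1_leading_eq_zero {n k : ℕ} (hkn : k + 1 ≤ n) {q : ℕ → K}
    (hq0 : ∀ m, 1 ≤ m → m < n → q m = 0) (hqn : q n ≠ 0) {v : Fin (k + 1) → K}
    (hv : v ᵥ* Wedge.Hankel.hankel1 K (n + n) k q = 0) : v = 0 := by
  -- the column `s` of `v ᵥ* H` reads `Σ_i v_i q_{i+s}`
  have hcol : ∀ s : ℕ, s < n + n + 1 - k → ∑ i : Fin (k + 1), v i * q ((i : ℕ) + s) = 0 := by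
    intro s hs
    have h := congr_fun hv ⟨s, hs⟩
    simpa [Matrix.vecMul, dotProduct, Wedge.Hankel.hankel1, Matrix.of_apply] using h
  -- descending induction: `v (k - j) = 0` for `j = 0, 1, …, k`
  have key : ∀ j, j ≤ k → v ⟨k - j, by omega⟩ = 0 := by
    intro j
    refine Nat.strong_induction_on j ?_
    intro j ih hj
    have hs : n - k + j < n + n + 1 - k := by omega
    have h := hcol (n - k + j) hs
    rw [Finset.sum_eq_single (⟨k - j, by omega⟩ : Fin (k + 1))] at h
    · -- the pivot term `v_{k-j} · q_n`
      have hidx : (k - j) + (n - k + j) = n := by omega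
      rw [show ((⟨k - j, by omega⟩ : Fin (k + 1)) : ℕ) = k - j from rfl, hidx] at h
      exact (mul_eq_zero.mp h).resolve_right hqn
    · intro i _ hi
      have hi' : (i : ℕ) ≠ k - j := fun h => hi (Fin.ext h)
      have hil := i.isLt
      by_cases hlt : k - j < (i : ℕ)
      · -- rows below the pivot: already zero by induction (`i = k - j'` with `j' < j`)
        have h' := ih (k - (i : ℕ)) (by omega) (by omega)
        have hfin : (⟨k - (k - (i : ℕ)), by omega⟩ : Fin (k + 1)) = i := Fin.ext (by simp only; omega)
        rw [hfin] at h'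
        rw [h', zero_mul]
      · -- rows above the pivot: the index `i + (n - k + j)` lies in `[1, n - 1]`, where `q` vanishes
        rw [hq0 _ (by omega) (by omega), mul_zero]
    · intro h
      exact absurd (Finset.mem_univ _) h
  funext i
  have hi := i.isLt
  have h := key (k - (i : ℕ)) (by omega)
  have hfin : (⟨k - (k - (i : ℕ)), by omega⟩ : Fin (k + 1)) = i := Fin.ext (by simp only; omega)
  rw [hfin] at h
  rw [h, Pi.zero_apply]

/-- **`rank H_k(q) = k + 1`** for `k + 1 ≤ n` when `q_m = 0` (`1 ≤ m ≤ n − 1`) and `q_n ≠ 0`: the `k + 1` rows are independent, so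
the rank is the full row count (computed as the rank of `H_k(q)ᵀ`, whose `mulVec` is `v ↦ v ᵥ* H_k(q)`, injective by the
staircase). [cite: BourbakiAlgebre1a3, Ch. III §8] -/
theorem hankel1_rank_leading {n k : ℕ} (hkn : k + 1 ≤ n) {q : ℕ → K}
    (hq0 : ∀ m, 1 ≤ m → m < n → q m = 0) (hqn : q n ≠ 0) :
    (Wedge.Hankel.hankel1 K (n + n) k q).rank = k + 1 := by
  set H := Wedge.Hankel.hankel1 K (n + n) k q with hH
  have hinj : Function.Injective (Hᵀ.mulVecLin) := by
    rw [← LinearMap.ker_eq_bot, LinearMap.ker_eq_bot']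
    intro v hv
    rw [Matrix.mulVecLin_apply, Matrix.mulVec_transpose] at hv
    exact vecMul_hankel1_leading_eq_zero hkn hq0 hqn hv
  rw [← Matrix.rank_transpose]
  change Module.finrank K ↥(LinearMap.range Hᵀ.mulVecLin) = k + 1
  rw [LinearMap.finrank_range_of_inj hinj, Module.finrank_fintype_fun_eq_card, Fintype.card_fin]

/-- **`P_f(q) = 2 q_0 q_{2n} + (-1)ⁿ C(2n,n) q_n²`** (`n ≥ 1`) when `q_m = 0` for `1 ≤ m ≤ n − 1`: in
`Σ_{j ≤ 2n} (-1)^j C(2n,j) q_j q_{2n-j}` every `j ∉ {0, n, 2n}` has `j` or `2n − j` in `[1, n − 1]`.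
[cite: BourbakiAlgebre1a3, Ch. III §8] -/
theorem mukaiP_leading {n : ℕ} (hn : 1 ≤ n) {q : ℕ → K} (hq0 : ∀ m, 1 ≤ m → m < n → q m = 0) :
    ∑ j ∈ Finset.range (n + n + 1), (-1 : K) ^ j * (((n + n).choose j : ℕ) : K) * (q j * q (n + n - j)) =
      2 * (q 0 * q (n + n)) + (-1 : K) ^ n * (((n + n).choose n : ℕ) : K) * (q n * q n) := by
  -- split off the three surviving indices `0 < n < 2n`
  have hmem0 : 0 ∈ Finset.range (n + n + 1) := by simp
  rw [← Finset.add_sum_erase _ _ hmem0]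
  have hmemn : n ∈ (Finset.range (n + n + 1)).erase 0 := by
    simp only [Finset.mem_erase, Finset.mem_range]; omega
  rw [← Finset.add_sum_erase _ _ hmemn]
  have hmem2 : n + n ∈ ((Finset.range (n + n + 1)).erase 0).erase n := by
    simp only [Finset.mem_erase, Finset.mem_range]; omega
  rw [← Finset.add_sum_erase _ _ hmem2]
  have hrest : ∑ j ∈ (((Finset.range (n + n + 1)).erase 0).erase n).erase (n + n),
      (-1 : K) ^ j * (((n + n).choose j : ℕ) : K) * (q j * q (n + n - j)) = 0 := by
    refine Finset.sum_eq_zero fun j hj => ?_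
    simp only [Finset.mem_erase, Finset.mem_range] at hj
    obtain ⟨hj2, hjn, hj0, hjr⟩ := hj
    by_cases hjlt : j < n
    · rw [hq0 j (by omega) hjlt, zero_mul, mul_zero]
    · rw [hq0 (n + n - j) (by omega) (by omega), mul_zero, mul_zero]
  have h2n : (-1 : K) ^ (n + n) = 1 := Even.neg_one_pow ⟨n, rfl⟩
  have hsub1 : n + n - n = n := Nat.add_sub_cancel_left n n
  have hsub2 : n + n - (n + n) = 0 := Nat.sub_self _
  rw [hrest, add_zero, h2n, hsub1, hsub2, Nat.sub_zero, pow_zero, Nat.choose_zero_right, Nat.choose_self, Nat.cast_one]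
  ring

end Summit.Ventures.HSemireg.Mod4
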